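import Summits.HodgeConjecture.HodgeConjecture.Theorems.SignSymmetricPowersGenCoverage
import HarnessLib

/-!
# K1-B piece LINK-G, part (C'): all ι-even forms with a FREE singular point lie on one prime factor of the
# restricted discriminant (route `SignSymmetricPowers`, item stmt-HodgeConjecture-19716)

Line `andre-zariski`, skeleton v12f (`276eda50fce4ca90`); helper file for the registered stub
`stub_signConfluenceLinkG` (LINK-G), landed `--supports stmt-HodgeConjecture-19716`.  This is the "same component"
input `hsame` of `SignSymmetricPowersLinkPairConjugacy.exists_conj_transport_of_pairs`, read off prover-A's orbit
families (`SignSymmetricPowersGenSingularFamilies`: the coefficient vectors of all `A_γ · F`, `F` singular at the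
reference free point `q = (1,0,1,0,0)`, form the image of a polynomial map — prime vanishing ideal — inside `V(D_M)`,
and contain every ι-even form singular at a free point, by block-diagonal transitivity
`SignSymmetricPowersGenBlockTransit.exists_commute_mulVec_eq_free`) and prime avoidance
(`SignSymmetricPowersMeridianIrreducible.exists_subset_zeroLocus_of_isPrime`):

* `exists_factor_of_free_singular` — sign family (`n = 3`, `M` the ι-even monomials, `γ = (−1,−1,1,1,1)`),
  `singularCoeffs = V(Disc)`, `d ≥ 2`, `D_M = killHom Disc = w · ∏ⱼ hⱼ^{eⱼ}` (unit `w`, `eⱼ ≥ 1`, any `hⱼ`): there is ONE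
  index `j₀` such that `h_{j₀}(coeff_M F) = 0` for EVERY `M`-supported degree-`d` form `F` with a singular point `z`
  off `Π ∪ L` (`(z₀,z₁) ≠ 0 ≠ (z₂,z₃,z₄)`).

Sorry-free; axioms standard; no definition, no named fact.

## References

* [GelfandKapranovZelevinsky1994] Gelfand–Kapranov–Zelevinsky, Discriminants, Resultants and Multidimensional
  Determinants, Ch. 1 §1.
* [Hartshorne1977] R. Hartshorne, Algebraic Geometry, I Prop. 1.13, I Ex. 5.8.
-/

noncomputable section

set_option linter.dupNamespace false

open MvPolynomial Matrix
open Literature.AlgebraicGeometry.Motives Literature.AlgebraicGeometry.Motives.UniversalHypersurface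
open Literature.AlgebraicGeometry.HodgeTheory
open Literature.Computability.AlgebraicComplexity
open Summit.HodgeConjecture.HodgeConjecture.Theorems.SignSymmetricPowersGenLinSubst
open Summit.HodgeConjecture.HodgeConjecture.Theorems.SignSymmetricPowersGenSingularFamilies
open Summit.HodgeConjecture.HodgeConjecture.Theorems.SignSymmetricPowersGenBlockTransit
open Summit.HodgeConjecture.HodgeConjecture.Theorems.SignSymmetricPowersGenCoverage
open Summit.HodgeConjecture.HodgeConjecture.Theorems.SignSymmetricPowersMeridianIrreducible

namespace Summit.HodgeConjecture.HodgeConjecture.Theorems.SignSymmetricPowersLinkSameFactor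

/-- **All ι-even forms with a free singular point lie on ONE prime factor of the restricted discriminant** (see
the module docstring). [cite: GelfandKapranovZelevinsky1994, Ch. 1 §1] [cite: Hartshorne1977, I Prop. 1.13] -/
theorem exists_factor_of_free_singular {d : ℕ} (hd : 2 ≤ d) {Disc : MvPolynomial (DegIndex 3 d) ℂ}
    (hV : ∀ a : DegIndex 3 d → ℂ, a ∈ singularCoeffs 3 d ↔ MvPolynomial.eval a Disc = 0)
    {m : ℕ} {w : MvPolynomial {m : DegIndex 3 d | Even (m.1 0 + m.1 1)} ℂ} (hw : IsUnit w)
    (h : Fin m → MvPolynomial {m : DegIndex 3 d | Even (m.1 0 + m.1 1)} ℂ) {e : Fin m → ℕ} (he : ∀ j, 1 ≤ e j)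
    (hfac : killHom ℂ 3 d {m : DegIndex 3 d | Even (m.1 0 + m.1 1)} Disc = w * ∏ j, h j ^ e j) :
    ∃ j₀, ∀ (F : MvPolynomial (Fin 5) ℂ) (z : Fin 5 → ℂ), F.IsHomogeneous d →
      IsSupportedOn 3 d {m : DegIndex 3 d | Even (m.1 0 + m.1 1)} F →
      (z 0 ≠ 0 ∨ z 1 ≠ 0) → (z 2 ≠ 0 ∨ z 3 ≠ 0 ∨ z 4 ≠ 0) → (∀ i, MvPolynomial.eval z (pderiv i F) = 0) →
      MvPolynomial.eval (fun m' : {m : DegIndex 3 d | Even (m.1 0 + m.1 1)} => coeff m'.1.1 F) (h j₀) = 0 := by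
  classical
  set γ : Fin 5 → ℂˣ := fun i : Fin 5 => if (i : ℕ) < 2 then -1 else 1 with hγdef
  have hM : ∀ m : DegIndex 3 d, m ∈ {m : DegIndex 3 d | Even (m.1 0 + m.1 1)} ↔ unitWeight ℂ 3 γ m.1 = 1 := fun m => mem_signMonomials_iff_unitWeight m
  have aeval_eq : ∀ (x : {m : DegIndex 3 d | Even (m.1 0 + m.1 1)} → ℂ) (q : MvPolynomial {m : DegIndex 3 d | Even (m.1 0 + m.1 1)} ℂ), MvPolynomial.aeval x q = MvPolynomial.eval x q :=
    fun x q => DFunLike.congr_fun (coe_aeval_eq_eval x) q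
  have hγD : (Matrix.diagonal fun i : Fin 5 => (γ i : ℂ)) =
      Matrix.diagonal (fun l : Fin 5 => if (l : ℕ) < 2 then (-1 : ℂ) else 1) := by
    congr 1; funext i; rw [hγdef]; dsimp only; split_ifs <;> simp
  -- the free orbit family
  have hpt : (![1, 0, 1, 0, 0] : Fin 5 → ℂ) ≠ 0 := fun h0 =>
    one_ne_zero (congr_fun h0 0 : (![1, 0, 1, 0, 0] : Fin 5 → ℂ) 0 = 0)
  obtain ⟨r, v, hvh, hvM, hvp, hspan⟩ := exists_spanning_family {m : DegIndex 3 d | Even (m.1 0 + m.1 1)} (![1, 0, 1, 0, 0] : Fin 5 → ℂ)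
  let R : Set ({m : DegIndex 3 d | Even (m.1 0 + m.1 1)} → ℂ) :=
    Set.range (fun x : ((Fin 5 × Fin 5) ⊕ Fin r) → ℂ => fun m : {m : DegIndex 3 d | Even (m.1 0 + m.1 1)} =>
      MvPolynomial.aeval x (coeff m.1.1 (linSubst (Fin 5) (MvPolynomial (((Fin 5 × Fin 5)) ⊕ Fin r) ℂ)
        (Matrix.of fun k l => if γ k = γ l then X (Sum.inl (k, l)) else 0)
        (∑ t, (X (Sum.inr t) : MvPolynomial (((Fin 5 × Fin 5)) ⊕ Fin r) ℂ) •
          MvPolynomial.map (C : ℂ →+* MvPolynomial (((Fin 5 × Fin 5)) ⊕ Fin r) ℂ) (v t)))))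
  have hRprime : (vanishingIdeal ℂ R).IsPrime := isPrime_vanishingIdeal_range_orbitFamily γ {m : DegIndex 3 d | Even (m.1 0 + m.1 1)} v
  have hDmem : killHom ℂ 3 d {m : DegIndex 3 d | Even (m.1 0 + m.1 1)} Disc ∈ vanishingIdeal ℂ R :=
    killHom_mem_vanishingIdeal_range_orbitFamily (γ := γ) (M := {m : DegIndex 3 d | Even (m.1 0 + m.1 1)}) (v := v) hd hM hV hpt hvh hvM hvp
  -- `R ⊆ ⋃ V(hⱼ)`
  have hsub : ∀ x ∈ R, ∃ j, MvPolynomial.aeval x (h j) = 0 := by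
    intro x hx
    have hDx : MvPolynomial.eval x (killHom ℂ 3 d {m : DegIndex 3 d | Even (m.1 0 + m.1 1)} Disc) = 0 := by
      have := (mem_vanishingIdeal_iff.mp hDmem) x hx
      rwa [aeval_eq] at this
    rw [hfac, map_mul, mul_eq_zero, map_prod, Finset.prod_eq_zero_iff] at hDx
    rcases hDx with hw0 | ⟨j, -, hj⟩
    · exact absurd hw0 (hw.map (MvPolynomial.eval x)).ne_zero
    · rw [map_pow] at hj
      have hej : e j ≠ 0 := by have := he j; omega
      refine ⟨j, ?_⟩
      rw [aeval_eq]
      exact (pow_eq_zero_iff hej).1 hj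
  obtain ⟨j₀, hj₀⟩ := exists_subset_zeroLocus_of_isPrime hRprime h hsub
  refine ⟨j₀, fun F z hF hFM h01 h234 hFz => ?_⟩
  -- `coeff_M F ∈ R` by block transitivity
  obtain ⟨N, hN, hNdet, hNz⟩ := exists_commute_mulVec_eq_free z h01 h234
  rw [← hγD] at hN
  have hmem : (fun m' : {m : DegIndex 3 d | Even (m.1 0 + m.1 1)} => coeff m'.1.1 F) ∈ R :=
    mem_range_orbitFamily_of_transit (γ := γ) (M := {m : DegIndex 3 d | Even (m.1 0 + m.1 1)}) (v := v) hM hspan hF hFM hFz hN hNdet hNz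
  have hfin := hj₀ _ hmem
  rw [aeval_eq] at hfin
  exact hfin

end Summit.HodgeConjecture.HodgeConjecture.Theorems.SignSymmetricPowersLinkSameFactor

end
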